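import Mathlib
import HarnessLib
import Summits.ResolutionOfSingularities.ResolutionOfSingularities.Theorems.HomologicalConductorNoZenoExtVanishingOmegaCM

/-!
# Crux `NoZenoR` / `NoZeno` (stmt-ResolutionOfSingularities-19943 / -16483), line
# `sandwich-cluster`, S3 Layer 2 — CA-layer: the (W)-rider DISCHARGED: `Ext¹_T(L*, T) = 0` for every
# high syzygy `L` over a two-dimensional normal local domain

Route `ResolutionOfSingularities/HomologicalConductor`.  OURS (cell res-hironaka, crux chain W4.4,
seat res-L0-w44-stub-5 = res-D-pv-037); nothing here is a statement of the manuscript under review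
(Hironaka 2017); AI-written, weaker than expert review.

Composition of the two halves of the (W)-rider of THEOREM A (CRUX-PLAN W4.4 v4.0.2 §1.3, «`M := L*`
is reflexive with `M* = L ∈ ΩCM(T)`, so `Ext¹_T(M, T) = 0` [IW 2.7]»; tri-1 TRIAGE v4 §7 F1: valid
for `L ∈ Ωⁿ⁻¹(mod T)` with `n ≥ 4` only):

* the CA2-free half `exists_extVanishingInput_dual_of_isSyzygy` (`…NoZenoHighSyzygyDual.lean`,
  p499134): for `T` a noetherian local domain and `L` an `(s+1)`-th syzygy of a finitely generated
  module with `s ≥ 2`, the defining sequence `0 → L → P → Ωˢ M → 0` meets the hypotheses of CA2 for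
  `X := L*`;
* CA2 `ext_one_eq_zero_of_dual_syzygy_of_reflexive` (res-D-pv-043,
  `…NoZenoExtVanishingOmegaCM.lean`, p501291): [Iyama–Wemyss 2.7 (e)⇒(d)] without completeness.

Result, in the three indexings the consumers use:
* `ext_one_dual_eq_zero_of_isSyzygy_succ` — `L ∈ Ωˢ⁺¹(M)`, `s ≥ 2`;
* `ext_one_dual_eq_zero_of_isSyzygy` — `L ∈ Ωˢ(M)`, `s ≥ 3`;
* `ext_one_dual_eq_zero_of_isSyzygy_pred` — `L ∈ Ωⁿ⁻¹(M)`, `n ≥ 4` (the indexing of CA4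
  `mem_cohomologyAnnihilatorOfDegree_iff_forall_dual_syzygy` and of Ga `Sig.stubG_caCarried`).

References: O. Iyama, M. Wemyss, *The classification of special Cohen–Macaulay modules*,
Math. Z. 265 (2010), Thm. 2.7 [`IyamaWemyss2009`].
-/

noncomputable section

-- single-problem summit: the doubled namespace component `ResolutionOfSingularities` is forced
set_option linter.dupNamespace false

namespace Summit.ResolutionOfSingularities.ResolutionOfSingularities.Theorems.NoZeno.SandwichCluster

open CategoryTheory CategoryTheory.Abelian Literature.RingTheory.CohomologyAnnihilator

universe u

variable {T : Type u} [CommRing T] [IsDomain T] [IsNoetherianRing T] [IsLocalRing T]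
  [IsIntegrallyClosed T]

/-- **The (W)-rider, discharged** (`Ωˢ⁺¹`, `s ≥ 2`): over a two-dimensional noetherian local normal
domain, for `M` finitely generated and `L` an `(s+1)`-th syzygy of `M` with `s ≥ 2`,
`Ext¹_T(L*, T) = 0` — CA2 applied to the package `exists_extVanishingInput_dual_of_isSyzygy`.
[cite: IyamaWemyss2009, Thm. 2.7] -/
theorem ext_one_dual_eq_zero_of_isSyzygy_succ (hdim : ringKrullDim T = 2) {s : ℕ} (hs : 2 ≤ s)
    {M L : ModuleCat.{u} T} (hM : Module.Finite T M) (hL : IsSyzygy (s + 1) M L)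
    (e : Ext.{u} (ModuleCat.of T (Module.Dual T L)) (ModuleCat.of T T) 1) : e = 0 := by
  obtain ⟨S, hS, e₁, hfin₂, hfree₂, hfin₃, hY, -⟩ :=
    exists_extVanishingInput_dual_of_isSyzygy hs hM hL
  haveI := hfin₂
  haveI := hfree₂
  haveI := hfin₃
  haveI : Module.Finite T (ModuleCat.of T (Module.Dual T L)) := finite_dual_of_isSyzygy hM hL
  exact ext_one_eq_zero_of_dual_syzygy_of_reflexive hdim (ModuleCat.of T (Module.Dual T L))
    (isReflexive_dual_of_isSyzygy (by omega) hL) S hS e₁ hY e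

/-- **The (W)-rider, discharged** (`Ωˢ`, `s ≥ 3`): over a two-dimensional noetherian local normal
domain, the dual `L*` of any `s`-th syzygy module `L` (`s ≥ 3`) of a finitely generated module
satisfies `Ext¹_T(L*, T) = 0`. [cite: IyamaWemyss2009, Thm. 2.7] -/
theorem ext_one_dual_eq_zero_of_isSyzygy (hdim : ringKrullDim T = 2) {s : ℕ} (hs : 3 ≤ s)
    {M L : ModuleCat.{u} T} (hM : Module.Finite T M) (hL : IsSyzygy s M L)
    (e : Ext.{u} (ModuleCat.of T (Module.Dual T L)) (ModuleCat.of T T) 1) : e = 0 := by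
  obtain ⟨t, rfl⟩ : ∃ t, s = t + 1 := ⟨s - 1, by omega⟩
  exact ext_one_dual_eq_zero_of_isSyzygy_succ hdim (by omega) hM hL e

/-- **The (W)-rider, discharged** (`Ωⁿ⁻¹`, `n ≥ 4` — the indexing of CA4 and of Ga
`Sig.stubG_caCarried`): over a two-dimensional noetherian local normal domain, for `n ≥ 4`, `M`
finitely generated and `L` an `(n-1)`-st syzygy of `M`, `Ext¹_T(L*, T) = 0`.  (At `n = 3` this
FAILS: `1/3(1,1)`, `L = S₁`, `L* = S₂`, tri-1 TRIAGE v4 §7 F1.) [cite: IyamaWemyss2009, Thm. 2.7] -/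
theorem ext_one_dual_eq_zero_of_isSyzygy_pred (hdim : ringKrullDim T = 2) {n : ℕ} (hn : 4 ≤ n)
    {M L : ModuleCat.{u} T} (hM : Module.Finite T M) (hL : IsSyzygy (n - 1) M L)
    (e : Ext.{u} (ModuleCat.of T (Module.Dual T L)) (ModuleCat.of T T) 1) : e = 0 :=
  ext_one_dual_eq_zero_of_isSyzygy hdim (s := n - 1) (by omega) hM hL e

end Summit.ResolutionOfSingularities.ResolutionOfSingularities.Theorems.NoZeno.SandwichCluster

end
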